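import Summits.MatrixMultiplication.MatrixMultiplication.Theorems.SoloInformedNearRect

/-!
# THEOREM 8.19 (assembled, every chart): a generic triple near-rectangle closes

This work, §8.8 (T12)(f) and C3-m2 §§5.5–5.6 (gen 107). Setting: a CU13-Def-12 realization of `⟨n,n,n⟩` in
`𝒮(S⁰ × S¹, ±)` [CohnUmans2013, arXiv:1207.6528, Def. 12] — equation data `D : Data ι G` (no 2-torsion), a chart
`Φ`, full separation, class map `κ : G → R` (`r = |R|`).

`Data.nearRect`: given `a ≈ [v′]` on `I₀ × 𝓛` and `b ≈ [v]` on `𝓛 × K₀` (every row / column of either block has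
`≤ e` exceptional cells; `|𝓛| > 2e`; generic classes `v, v′ ≠ 0`, `v ≁ v′`), the columns `K₀` split as
`K₀ = K_c ⊔ K₊ ⊔ K₋` with
* `K_c` (no `b`-deviation on `𝓛`): the rows `𝓛` of `b` agree there, so (T2a) `n·|K_c|·|𝓛| ≤ r·|S⁰|`;
* `K₊` (pinned to `[v′+v]`), `K₋` (pinned to `[v′−v]`): each, when larger than `2e`, carries a 2-classed box
  `I₁ × 𝓛 × K_±` off `≤ 2e` rows with `|I₁|·|𝓛|·|K_±| ≤ |S⁰| + e|𝓛||K_±| + e|𝓛||I₁| + e|K_±||𝓛|`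
  (`Data.nearRect_core`, THEOREM 8.18).
With `|𝓛| ≥ λn`, `|I₀|, |K₀| ≥ μn`, `e ≤ εn`, `ε ≤ λμ²/64` this is THEOREM 8.19's `r·|S⁰| ≥ (λμ²/16)·n³`
(C3-m2 §5.6); the arithmetic is left to the reader of the three inequalities.
-/

namespace Summit.MatrixMultiplication.MatrixMultiplication.Theorems.TwistedTPP

namespace FibreLines

variable {ι G : Type*} [AddCommGroup G]
variable {G₀ : Type*} [AddCommGroup G₀] {R : Type*}

/-- **THEOREM 8.19 (every chart, structural form).** [this work, §8.8 (T12)(f); C3-m2 §5.5] -/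
theorem Data.nearRect [Fintype ι] [DecidableEq ι] [Fintype G₀] [DecidableEq G₀] [Fintype R]
    [DecidableEq R] [DecidableEq G] (hG : ∀ x : G, x = -x → x = 0) (D : Data ι G) (Φ : Chart ι G₀)
    (κ : G → R) (hκ : ∀ x y, κ x = κ y → SignEq x y) (hsep : D.SepAll Φ) {v v' : G} (hv : v ≠ 0)
    (hv' : v' ≠ 0) (hvv : ¬ SignEq v v') (I₀ L K₀ : Finset ι) (e : ℕ)
    (hac : ∀ j ∈ L, ∃ E : Finset ι, E.card ≤ e ∧ ∀ i ∈ I₀, i ∉ E → SignEq (D.a i j) v')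
    (har : ∀ i ∈ I₀, ∃ E : Finset ι, E.card ≤ e ∧ ∀ j ∈ L, j ∉ E → SignEq (D.a i j) v')
    (hbr : ∀ j ∈ L, ∃ E : Finset ι, E.card ≤ e ∧ ∀ k ∈ K₀, k ∉ E → SignEq (D.b j k) v)
    (hbc : ∀ k ∈ K₀, ∃ E : Finset ι, E.card ≤ e ∧ ∀ j ∈ L, j ∉ E → SignEq (D.b j k) v)
    (hL : 2 * e < L.card) :
    ∃ Kc ⊆ K₀, ∃ Kp ⊆ K₀, ∃ Km ⊆ K₀, K₀.card = Kc.card + Kp.card + Km.card ∧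
      Fintype.card ι * Kc.card * L.card ≤ Fintype.card R * Fintype.card G₀ ∧
      (2 * e < Kp.card → ∃ I₁ ⊆ I₀, I₀.card ≤ I₁.card + 2 * e ∧
        I₁.card * L.card * Kp.card ≤ Fintype.card G₀ + e * (L.card * Kp.card) +
          e * (L.card * I₁.card) + e * (Kp.card * L.card)) ∧
      (2 * e < Km.card → ∃ I₁ ⊆ I₀, I₀.card ≤ I₁.card + 2 * e ∧
        I₁.card * L.card * Km.card ≤ Fintype.card G₀ + e * (L.card * Km.card) +
          e * (L.card * I₁.card) + e * (Km.card * L.card)) := by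
  classical
  have hs : v + v' ≠ 0 := fun h => hvv (Or.inr (eq_neg_of_add_eq_zero_left h))
  have hs' : -v + v' ≠ 0 := fun h => hvv (Or.inl (neg_add_eq_zero.1 h))
  -- the deviation row of a dirty column
  let jd : ι → ι := fun k => if h : ∃ j ∈ L, ¬ SignEq (D.b j k) v then h.choose else k
  have hjd : ∀ k, (∃ j ∈ L, ¬ SignEq (D.b j k) v) → jd k ∈ L ∧ ¬ SignEq (D.b (jd k) k) v := by
    intro k h
    have e1 : jd k = h.choose := dif_pos h
    rw [e1]; exact h.choose_spec
  set Kc : Finset ι := K₀.filter fun k => ∀ j ∈ L, SignEq (D.b j k) v with hKc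
  set Kd : Finset ι := K₀.filter fun k => ¬ ∀ j ∈ L, SignEq (D.b j k) v with hKd
  have hKd : ∀ k ∈ Kd, k ∈ K₀ ∧ jd k ∈ L ∧ ¬ SignEq (D.b (jd k) k) v := by
    intro k hk
    obtain ⟨hk₀, hne⟩ := Finset.mem_filter.1 hk
    push Not at hne
    exact ⟨hk₀, hjd k hne⟩
  set Kp : Finset ι := Kd.filter fun k => ∀ i ∈ I₀, SignEq (D.a i (jd k)) v' → SignEq (D.c k i) (v' + v)
    with hKp
  set Km : Finset ι := Kd.filter fun k =>
    ¬ ∀ i ∈ I₀, SignEq (D.a i (jd k)) v' → SignEq (D.c k i) (v' + v) with hKm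
  have hKpd : Kp ⊆ Kd := Finset.filter_subset _ _
  have hKmd : Km ⊆ Kd := Finset.filter_subset _ _
  have hKd₀ : Kd ⊆ K₀ := Finset.filter_subset _ _
  refine ⟨Kc, Finset.filter_subset _ _, Kp, hKpd.trans hKd₀, Km, hKmd.trans hKd₀, ?_, ?_, ?_, ?_⟩
  · have h1 : Kc.card + Kd.card = K₀.card := Finset.card_filter_add_card_filter_not _
    have h2 : Kp.card + Km.card = Kd.card := Finset.card_filter_add_card_filter_not _
    omega
  · exact D.card_mul_le_of_b_rowsOn₂ Φ κ hκ hsep L Kc fun j hj j' hj' k hk =>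
      ((Finset.mem_filter.1 hk).2 j' hj').trans ((Finset.mem_filter.1 hk).2 j hj).symm
  · intro hKp2
    refine D.nearRect_core hG Φ hsep hv hv' hs I₀ L Kp e jd (fun k hk => (hKd k (hKpd hk)).2.1) hac har
      (fun j hj => ?_) (fun k hk => hbc k (hKd₀ (hKpd hk))) (fun k hk => (Finset.mem_filter.1 hk).2)
      hL hKp2
    obtain ⟨E, hE, hEb⟩ := hbr j hj
    exact ⟨E, hE, fun k hk hkE => hEb k (hKd₀ (hKpd hk)) hkE⟩
  · intro hKm2
    have hpin : ∀ k ∈ Km, ∀ i ∈ I₀, SignEq (D.a i (jd k)) v' → SignEq (D.c k i) (v' + -v) := by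
      intro k hk
      obtain ⟨hkd, hno⟩ := Finset.mem_filter.1 hk
      obtain ⟨hk₀, hjL, hdev⟩ := hKd k hkd
      rcases D.c_row_pinned hG I₀ L e (fun h => hdev h.symm) har (hbc k hk₀) hL with h | h
      · exact absurd h hno
      · intro i hi hai; rw [← sub_eq_add_neg]; exact h i hi hai
    refine D.nearRect_core hG Φ hsep (neg_ne_zero.2 hv) hv' hs' I₀ L Km e jd
      (fun k hk => (hKd k (hKmd hk)).2.1) hac har (fun j hj => ?_) (fun k hk => ?_) hpin hL hKm2
    · obtain ⟨E, hE, hEb⟩ := hbr j hj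
      exact ⟨E, hE, fun k hk hkE => signEq_neg_right.2 (hEb k (hKd₀ (hKmd hk)) hkE)⟩
    · obtain ⟨E, hE, hEb⟩ := hbc k (hKd₀ (hKmd hk))
      exact ⟨E, hE, fun j hj hjE => signEq_neg_right.2 (hEb j hj hjE)⟩

end FibreLines

end Summit.MatrixMultiplication.MatrixMultiplication.Theorems.TwistedTPP
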